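import Literature.Computability.Complexity.NCIteratedAddition
import Literature.Computability.Complexity.IteratedAdditionBits
import HarnessLib

/-!
# Weighted thresholds in logarithmic depth over `B₂` (Vollmer 1999, Thm. 1.20 and Thm. 1.24)

The bounded fan-in endgame of iterated addition and majority: from the carry-save tree of
`NCIteratedAddition.lean` (two `W`-bit numbers `s, e` with `s + e ≡ ∑ⱼ cⱼ[yⱼ] (mod 2^W)`) we

* add the two numbers in depth `O(log W)`: bit `k` of `s + e` is `sₖ ⊕ eₖ ⊕ carryₖ` with the
  carry look-ahead formula `carryₖ ⟺ ∃ t < k, (sₜ ∧ eₜ) ∧ ∀ u ∈ (t, k), (sᵤ ∨ eᵤ)`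
  (`IteratedAdditionBits.testBit_add_eq_xor_carry`; Vollmer 1999, §1.1 and Cor. 1.18,
  `ADD ∈ FSIZE-DEPTH(n^{O(1)}, log n)`), realized as an `∨` of `∧`-trees of fan-in-2 gates
  (`ncVec_carryAt`, `ncVec_addBits`);
* compare the sum with a hard-wired constant `θ` in depth `O(log W)` (`ncVec_geConst`): for
  `0 < θ < 2^W`, `θ ≤ v ⟺` bit `W` of `v + (2^W - θ)` is on, again a carry
  (Vollmer 1999, Thm. 1.24: "we compare this number with the number `n/2` which we hardwire
  into the circuit").

**Main theorem** (`ncVec_wsumGe`): for weights `cⱼ < 2^B` (`j < M`) and any `θ`, the weighted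
threshold `[θ ≤ ∑ⱼ cⱼ·[yⱼ]]` of `M` input bits has `B₂`-circuits of depth
`wsumDepth M B = 14⌈log₂ M⌉ + 4⌈log₂(B + ⌈log₂ M⌉)⌉ + 12` and size `wsumSize M B` (a polynomial in
`M` and `B`). With unit weights this is `MAJ ∈ DEPTH(log n)` (Vollmer 1999, Thm. 1.24); the
weighted form is what the simulation of `TC⁰` gates with repeated inputs needs
(`ConstantDepth.lean`, `TC0_subset_NC1`).

## References

* H. Vollmer, *Introduction to Circuit Complexity* (Springer, 1999), §1.1 (carry look-ahead),
  Cor. 1.18, Thm. 1.20 (`ITADD`), Cor. 1.22 (`BCOUNT`), Thm. 1.24 (`MAJ ∈ DEPTH(log n)`)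
  [Vollmer1999].
-/

namespace Literature.Computability.Complexity

open Finset CarrySave

/-! ### Constants, and the conjunction / disjunction of many realized bits -/

/-- A constant output costs one gate of arity `0` (depth `1`). [folklore] -/
theorem ncVec_const {ι : Type*} (b : Bool) : NCVec (fun (_ : ι → Bool) (_ : Unit) => b) 1 1 :=
  (ncVec_gate ⟨0, fun _ => b⟩ (by simp [B2]) Fin.elim0).congr fun _ _ => rfl

/-- The tree operation "conjunction" on one-bit values. [folklore] -/
def andOp (u v : Fin 1 → Bool) : Fin 1 → Bool := fun _ => u 0 && v 0

/-- The tree operation "disjunction" on one-bit values. [folklore] -/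
def orOp (u v : Fin 1 → Bool) : Fin 1 → Bool := fun _ => u 0 || v 0

/-- `∧₂` as a tree gadget: depth `1`, size `1`. [folklore] -/
theorem ncVec_andOp :
    NCVec (fun (y : Fin 1 ⊕ Fin 1 → Bool) => andOp (fun i => y (.inl i)) fun i => y (.inr i)) 1 1 :=
  ((((ncVec_proj (_root_.id : Fin 1 ⊕ Fin 1 → Fin 1 ⊕ Fin 1)).gate₂ (· && ·) (.inl 0)
    (.inr 0)).outMap fun _ : Fin 1 => ()).congr fun _ _ => rfl).mono (by simp) (by simp)

/-- `∨₂` as a tree gadget: depth `1`, size `1`. [folklore] -/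
theorem ncVec_orOp :
    NCVec (fun (y : Fin 1 ⊕ Fin 1 → Bool) => orOp (fun i => y (.inl i)) fun i => y (.inr i)) 1 1 :=
  ((((ncVec_proj (_root_.id : Fin 1 ⊕ Fin 1 → Fin 1 ⊕ Fin 1)).gate₂ (· || ·) (.inl 0)
    (.inr 0)).outMap fun _ : Fin 1 => ()).congr fun _ _ => rfl).mono (by simp) (by simp)

/-- Every index of `Fin N` lies in the first `h` or in the last `N - h` positions (the two
halves of `treeFold`). [folklore] -/
theorem fin_halves_cover {N : ℕ} (h : ℕ) (hh : h ≤ N) (j : Fin N) :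
    (∃ j₁ : Fin h, Fin.castLE hh j₁ = j) ∨ ∃ j₂ : Fin (N - h), (⟨h + (j₂ : ℕ), by omega⟩ : Fin N) = j := by
  by_cases hj : (j : ℕ) < h
  · exact Or.inl ⟨⟨j, hj⟩, rfl⟩
  · exact Or.inr ⟨⟨(j : ℕ) - h, by omega⟩, Fin.ext (show h + ((j : ℕ) - h) = j by omega)⟩

/-- **Semantics of the `∧`-tree**: the balanced fold of `∧` is on iff all leaves are on. [folklore] -/
theorem treeFold_andOp : ∀ (M : ℕ) (f : Fin M → Fin 1 → Bool),
    treeFold andOp (fun _ => true) M f 0 = true ↔ ∀ j, f j 0 = true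
  | 0, f => by simp [treeFold]
  | 1, f => by
    rw [treeFold]
    exact ⟨fun h j => by rwa [Subsingleton.elim j 0], fun h => h 0⟩
  | M + 2, f => by
    rw [treeFold]
    show (treeFold andOp _ _ _ 0 && treeFold andOp _ _ _ 0) = true ↔ _
    rw [Bool.and_eq_true, treeFold_andOp, treeFold_andOp]
    constructor
    · rintro ⟨h1, h2⟩ j
      rcases fin_halves_cover ((M + 2) / 2) (Nat.div_le_self _ _) j with ⟨j₁, rfl⟩ | ⟨j₂, rfl⟩
      · exact h1 j₁
      · exact h2 j₂
    · exact fun h => ⟨fun j => h _, fun j => h _⟩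

/-- **Semantics of the `∨`-tree**: the balanced fold of `∨` is on iff some leaf is on. [folklore] -/
theorem treeFold_orOp : ∀ (M : ℕ) (f : Fin M → Fin 1 → Bool),
    treeFold orOp (fun _ => false) M f 0 = true ↔ ∃ j, f j 0 = true
  | 0, f => by simp [treeFold]
  | 1, f => by
    rw [treeFold]
    exact ⟨fun h => ⟨0, h⟩, fun ⟨j, h⟩ => by rwa [Subsingleton.elim j 0] at h⟩
  | M + 2, f => by
    rw [treeFold]
    show (treeFold orOp _ _ _ 0 || treeFold orOp _ _ _ 0) = true ↔ _
    rw [Bool.or_eq_true, treeFold_orOp, treeFold_orOp]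
    constructor
    · rintro (⟨j, h⟩ | ⟨j, h⟩) <;> exact ⟨_, h⟩
    · rintro ⟨j, h⟩
      rcases fin_halves_cover ((M + 2) / 2) (Nat.div_le_self _ _) j with ⟨j₁, rfl⟩ | ⟨j₂, rfl⟩
      · exact Or.inl ⟨j₁, h⟩
      · exact Or.inr ⟨j₂, h⟩

namespace NCVec

variable {ι : Type*} {n d s : ℕ} {G : (ι → Bool) → Fin n → Bool}

/-- **The conjunction of `n ≥ 1` realized bits** costs `⌈log₂ n⌉` more depth and `n - 1` more
gates (a balanced `∧`-tree; Vollmer 1999, §1.3). [cite: Vollmer1999, §1.3] -/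
theorem allOf (hG : NCVec G d s) (hn : 1 ≤ n) :
    NCVec (fun x (_ : Unit) => decide (∀ j, G x j = true)) (d + Nat.clog 2 n) (s + (n - 1)) := by
  have h := (hG.outMap fun p : Fin n × Fin 1 => p.1).comp
    (NCVec.treeGadget ncVec_andOp (fun _ => true) n hn)
  refine ((h.outMap fun _ : Unit => (0 : Fin 1)).congr fun x _ => ?_).mono (by simp) (by simp)
  rw [Bool.eq_iff_iff, decide_eq_true_iff]
  exact treeFold_andOp n _

/-- **The disjunction of `n ≥ 1` realized bits** costs `⌈log₂ n⌉` more depth and `n - 1` more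
gates (a balanced `∨`-tree; Vollmer 1999, §1.3). [cite: Vollmer1999, §1.3] -/
theorem anyOf (hG : NCVec G d s) (hn : 1 ≤ n) :
    NCVec (fun x (_ : Unit) => decide (∃ j, G x j = true)) (d + Nat.clog 2 n) (s + (n - 1)) := by
  have h := (hG.outMap fun p : Fin n × Fin 1 => p.1).comp
    (NCVec.treeGadget ncVec_orOp (fun _ => false) n hn)
  refine ((h.outMap fun _ : Unit => (0 : Fin 1)).congr fun x _ => ?_).mono (by simp) (by simp)
  rw [Bool.eq_iff_iff, decide_eq_true_iff]
  exact treeFold_orOp n _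

end NCVec

/-! ### Carry look-ahead -/

/-- The carry INTO position `k` of an addition with generate bits `g` and propagate bits `p`:
generated at some `t < k` and propagated at all positions strictly between `t` and `k`
(Vollmer 1999, §1.1, the formulae for `cᵢ`; `IteratedAdditionBits.testBit_add_eq_xor_carry`). [cite: Vollmer1999, §1.1] -/
def CarryAt (k : ℕ) (g p : ℕ → Bool) : Prop := ∃ t < k, g t = true ∧ ∀ u < k, t < u → p u = true

/-- The carry predicate quantifies over finitely many positions, hence is decidable. [folklore] -/
instance CarryAt.decidable (k : ℕ) (g p : ℕ → Bool) : Decidable (CarryAt k g p) := by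
  unfold CarryAt; infer_instance

/-- The carry as an `∨` over the generating position `t` of an `∧` over the `k - t` bits
`gₜ, p_{t+1}, …, p_{k-1}`. [cite: Vollmer1999, §1.1] -/
theorem carryAt_iff_fin (k : ℕ) (g p : ℕ → Bool) :
    CarryAt k g p ↔
      ∃ t : Fin k, ∀ r : Fin (k - t), (if (r : ℕ) = 0 then g t else p (t + r)) = true := by
  constructor
  · rintro ⟨t, ht, hg, hp⟩
    refine ⟨⟨t, ht⟩, fun r => ?_⟩
    by_cases hr : (r : ℕ) = 0
    · simpa [hr] using hg
    · simp only [hr, ↓reduceIte]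
      exact hp _ (by omega) (by omega)
  · rintro ⟨t, H⟩
    refine ⟨t, t.2, ?_, fun u hu htu => ?_⟩
    · simpa using H ⟨0, by omega⟩
    · have h := H ⟨u - t, by omega⟩
      have hne : (u - (t : ℕ)) ≠ 0 := by omega
      simp only [hne, ↓reduceIte] at h
      rwa [Nat.add_sub_cancel' htu.le] at h

/-- **Carry look-ahead in logarithmic depth.** If every generate bit `gₜ` and propagate bit `pₜ`
(`t < k`) is realized at depth `d` with `s` gates, the carry into position `k` is realized at
depth `d + 2⌈log₂ k⌉ + 1` with `k(ks + k) + k + 1` gates (an `∨`-tree of `∧`-trees; Vollmer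
1999, §1.1 with Cor. 1.18). [cite: Vollmer1999, Corollary 1.18] -/
theorem ncVec_carryAt {ι : Type*} {k d s : ℕ} {G P : (ι → Bool) → ℕ → Bool}
    (hG : ∀ t < k, NCVec (fun x (_ : Unit) => G x t) d s)
    (hP : ∀ t < k, NCVec (fun x (_ : Unit) => P x t) d s) :
    NCVec (fun x (_ : Unit) => decide (CarryAt k (G x) (P x)))
      (d + Nat.clog 2 k + Nat.clog 2 k + 1) (k * (k * s + k) + k + 1) := by
  rcases Nat.eq_zero_or_pos k with rfl | hk
  · refine ((ncVec_const false).congr fun x _ => ?_).mono (by omega) (by omega)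
    rw [eq_comm, decide_eq_false_iff_not]
    rintro ⟨t, ht, -⟩
    exact absurd ht (Nat.not_lt_zero t)
  · have hterm : ∀ t : Fin k, NCVec (fun x (r : Fin (k - t)) =>
        if (r : ℕ) = 0 then G x t else P x (t + r)) d ((k - t) * s) := fun t =>
      NCVec.pi_fin fun r => by
        by_cases hr : (r : ℕ) = 0
        · simpa [hr] using hG t t.2
        · simpa [hr] using hP (t + r) (by omega)
    have hall : ∀ t : Fin k, NCVec (fun x (_ : Unit) =>
        decide (∀ r : Fin (k - t), (if (r : ℕ) = 0 then G x t else P x (t + r)) = true))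
        (d + Nat.clog 2 k) (k * s + k) := fun t => by
      refine ((hterm t).allOf (by omega)).mono
        (Nat.add_le_add_left (Nat.clog_mono_right 2 (Nat.sub_le k t)) d) ?_
      have := Nat.mul_le_mul_right s (Nat.sub_le k t)
      omega
    have hany := (NCVec.pi_fin hall).anyOf hk
    refine (hany.congr fun x _ => ?_).mono (by omega) (by omega)
    rw [decide_eq_decide]
    simp only [decide_eq_true_iff]
    exact (carryAt_iff_fin k (G x) (P x)).symm

/-! ### Adding the two numbers of a carry-save pair -/

/-- Size of the adder producing the `W` low bits of `s + e`. [folklore] -/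
def addBitsSize (W : ℕ) : ℕ := W * (1 + (W * (W * 1 + W) + W + 1) + 1)

/-- **The low `W` bits of the sum of a carry-save pair in depth `O(log W)`**: bit `k` is
`sₖ ⊕ eₖ ⊕ carryₖ` with the look-ahead carry (Vollmer 1999, §1.1 and Cor. 1.18,
`ADD ∈ FSIZE-DEPTH(n^{O(1)}, log n)`; `testBit_add_eq_xor_carry`). Depth `2⌈log₂ W⌉ + 4`. [cite: Vollmer1999, Corollary 1.18] -/
theorem ncVec_addBits (W : ℕ) :
    NCVec (fun (v : Fin (W + W) → Bool) (k : Fin W) =>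
        (Nat.ofBits (loHalf v) + Nat.ofBits (hiHalf v)).testBit k)
      (Nat.clog 2 W + Nat.clog 2 W + 4) (addBitsSize W) := by
  refine NCVec.pi_fin fun k => ?_
  -- generate and propagate bits, as functions of all positions `t : ℕ`
  let G : (Fin (W + W) → Bool) → ℕ → Bool := fun v t =>
    if h : t < W then v (Fin.castAdd W ⟨t, h⟩) && v (Fin.natAdd W ⟨t, h⟩) else false
  let P : (Fin (W + W) → Bool) → ℕ → Bool := fun v t =>
    if h : t < W then v (Fin.castAdd W ⟨t, h⟩) || v (Fin.natAdd W ⟨t, h⟩) else false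
  have hG : ∀ t < (k : ℕ), NCVec (fun v (_ : Unit) => G v t) 1 1 := fun t ht => by
    have htW : t < W := ht.trans k.2
    exact (((ncVec_proj (_root_.id : Fin (W + W) → Fin (W + W))).gate₂ (· && ·)
      (Fin.castAdd W ⟨t, htW⟩) (Fin.natAdd W ⟨t, htW⟩)).congr fun v _ => by simp [G, htW]).mono
      (by simp) (by simp)
  have hP : ∀ t < (k : ℕ), NCVec (fun v (_ : Unit) => P v t) 1 1 := fun t ht => by
    have htW : t < W := ht.trans k.2
    exact (((ncVec_proj (_root_.id : Fin (W + W) → Fin (W + W))).gate₂ (· || ·)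
      (Fin.castAdd W ⟨t, htW⟩) (Fin.natAdd W ⟨t, htW⟩)).congr fun v _ => by simp [P, htW]).mono
      (by simp) (by simp)
  have hc := ncVec_carryAt hG hP
  have hx : NCVec (fun (v : Fin (W + W) → Bool) (_ : Unit) =>
      (v (Fin.castAdd W k)).xor (v (Fin.natAdd W k))) 1 1 :=
    (((ncVec_proj (_root_.id : Fin (W + W) → Fin (W + W))).gate₂ Bool.xor (Fin.castAdd W k)
      (Fin.natAdd W k)).congr fun v _ => rfl).mono (by simp) (by simp)
  have h := (hx.pair hc).gate₂ Bool.xor (.inl ()) (.inr ())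
  refine (h.congr fun v _ => ?_).mono ?_ ?_
  · simp only [Sum.elim_inl, Sum.elim_inr]
    rw [testBit_add_eq_xor_carry, Nat.testBit_ofBits_lt _ _ k.2, Nat.testBit_ofBits_lt _ _ k.2]
    simp only [loHalf, hiHalf, Fin.eta]
    congr 1
    rw [decide_eq_decide]
    unfold CarryAt
    refine exists_congr fun t => and_congr_right fun ht => and_congr ?_
      (forall_congr' fun u => imp_congr_right fun hu => imp_congr_right fun _ => ?_)
    · have htW : t < W := ht.trans k.2
      simp [G, htW, loHalf, hiHalf, Nat.testBit_ofBits_lt _ _ htW]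
    · have huW : u < W := hu.trans k.2
      simp [P, huW, loHalf, hiHalf, Nat.testBit_ofBits_lt _ _ huW]
  · have := Nat.clog_mono_right 2 (le_of_lt k.2)
    rw [max_eq_right (by omega)]
    omega
  · have h1 : (k : ℕ) * ((k : ℕ) * 1 + k) ≤ W * (W * 1 + W) :=
      Nat.mul_le_mul (le_of_lt k.2) (by have := k.2; omega)
    have := k.2
    omega

/-! ### Comparison with a hard-wired constant -/

/-- The top bit of a number below `2^(W+1)` tells whether it is at least `2^W`. [folklore] -/
theorem testBit_eq_decide_le {x W : ℕ} (hx : x < 2 ^ (W + 1)) :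
    x.testBit W = decide (2 ^ W ≤ x) := by
  rw [Nat.testBit_eq_decide_div_mod_eq]
  have h2 : x / 2 ^ W < 2 := by
    rw [Nat.div_lt_iff_lt_mul (by positivity), ← Nat.pow_succ']
    exact hx
  rcases Nat.lt_or_ge x (2 ^ W) with h | h
  · rw [Nat.div_eq_of_lt h]
    simp [Nat.not_le.2 h]
  · have h1 : x / 2 ^ W = 1 := by
      have := Nat.div_pos h (by positivity)
      omega
    rw [h1]
    simp [h]

/-- Size of the comparator with a constant. [folklore] -/
def geConstSize (W : ℕ) : ℕ := W * (W * 1 + W) + W + 1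

/-- **Comparison with a hard-wired constant in depth `O(log W)`**: `[θ ≤ v]` for a `W`-bit
number `v`; for `0 < θ < 2^W` it is bit `W` of `v + (2^W - θ)`, a look-ahead carry over the
generate bits `vₜ ∧ Kₜ` and propagate bits `vₜ ∨ Kₜ` of the constant `K = 2^W - θ`
(Vollmer 1999, Thm. 1.24: "compare this number with the number … which we hardwire into the
circuit"). Depth `2⌈log₂ W⌉ + 2`. [cite: Vollmer1999, Theorem 1.24] -/
theorem ncVec_geConst (W θ : ℕ) :
    NCVec (fun (v : Fin W → Bool) (_ : Unit) => decide (θ ≤ Nat.ofBits v))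
      (Nat.clog 2 W + Nat.clog 2 W + 2) (geConstSize W) := by
  have hs1 : 1 ≤ geConstSize W := Nat.le_add_left 1 _
  rcases Nat.eq_zero_or_pos θ with rfl | hθ
  · exact ((ncVec_const true).congr fun v _ => by simp).mono (by omega) hs1
  by_cases hbig : 2 ^ W ≤ θ
  · refine ((ncVec_const false).congr fun v _ => ?_).mono (by omega) hs1
    rw [eq_comm, decide_eq_false_iff_not, not_le]
    exact (Nat.ofBits_lt_two_pow v).trans_le hbig
  rw [not_le] at hbig
  set K := 2 ^ W - θ with hK
  have hKlt : K < 2 ^ W := by omega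
  let G : (Fin W → Bool) → ℕ → Bool := fun v t => if h : t < W then v ⟨t, h⟩ && K.testBit t else false
  let P : (Fin W → Bool) → ℕ → Bool := fun v t => if h : t < W then v ⟨t, h⟩ || K.testBit t else false
  have hG : ∀ t < W, NCVec (fun v (_ : Unit) => G v t) 1 1 := fun t ht => by
    by_cases hb : K.testBit t = true
    · exact ((ncVec_proj fun _ : Unit => (⟨t, ht⟩ : Fin W)).congr fun v _ => by
        simp [G, ht, hb]).mono zero_le_one zero_le_one
    · exact (ncVec_const false).congr fun v _ => by simp [G, ht, hb]
  have hP : ∀ t < W, NCVec (fun v (_ : Unit) => P v t) 1 1 := fun t ht => by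
    by_cases hb : K.testBit t = true
    · exact (ncVec_const true).congr fun v _ => by simp [P, ht, hb]
    · exact ((ncVec_proj fun _ : Unit => (⟨t, ht⟩ : Fin W)).congr fun v _ => by
        simp [P, ht, hb]).mono zero_le_one zero_le_one
  have hc := ncVec_carryAt (k := W) hG hP
  refine (hc.congr fun v _ => ?_).mono (by omega) le_rfl
  -- `θ ≤ v ⟺ 2^W ≤ v + K ⟺ bit W of v + K ⟺ the carry into position W`
  have hv := Nat.ofBits_lt_two_pow v
  have hbit : (Nat.ofBits v + K).testBit W = decide (θ ≤ Nat.ofBits v) := by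
    rw [testBit_eq_decide_le (by rw [pow_succ]; omega)]
    refine decide_eq_decide.2 ⟨fun h => ?_, fun h => ?_⟩ <;> omega
  rw [← hbit, testBit_add_eq_xor_carry, Nat.testBit_lt_two_pow hv, Nat.testBit_lt_two_pow hKlt]
  simp only [Bool.false_xor]
  rw [decide_eq_decide]
  unfold CarryAt
  refine exists_congr fun t => and_congr_right fun ht => and_congr ?_
    (forall_congr' fun u => imp_congr_right fun hu => imp_congr_right fun _ => ?_)
  · simp [G, ht, Nat.testBit_ofBits_lt _ _ ht]
  · simp [P, hu, Nat.testBit_ofBits_lt _ _ hu]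

/-! ### The weighted threshold -/

/-- The working width: `B + ⌈log₂ M⌉` bits hold every partial sum of `M` numbers below `2^B`. [folklore] -/
def wsumWidth (M B : ℕ) : ℕ := B + Nat.clog 2 M

/-- Depth of the threshold circuits: `14⌈log₂ M⌉ + 4⌈log₂ W⌉ + 12`, `W = wsumWidth M B`. [folklore] -/
def wsumDepth (M B : ℕ) : ℕ := 14 * Nat.clog 2 M + 4 * Nat.clog 2 (wsumWidth M B) + 12

/-- Size of the threshold circuits (tree + adder + comparator), a polynomial in `M`, `B`. [folklore] -/
def wsumSize (M B : ℕ) : ℕ :=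
  (M * ((wsumWidth M B + wsumWidth M B) * 1) +
      (M - 1) * ((wsumWidth M B + wsumWidth M B) * 36 + (wsumWidth M B + wsumWidth M B) * 36)) +
    addBitsSize (wsumWidth M B) + geConstSize (wsumWidth M B)

/-- The weighted sum of `M` bits with weights below `2^B` is below `2^(B + ⌈log₂ M⌉)`. [folklore] -/
theorem wsum_lt_two_pow_wsumWidth (M B : ℕ) (c : Fin M → ℕ) (hc : ∀ j, c j < 2 ^ B)
    (y : Fin M → Bool) : ∑ j, c j * (y j).toNat < 2 ^ wsumWidth M B := by
  rcases Nat.eq_zero_or_pos M with rfl | hM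
  · simp
  have h1 : ∑ j, c j * (y j).toNat ≤ ∑ _j : Fin M, (2 ^ B - 1) := Finset.sum_le_sum fun j _ => by
    have := hc j
    have : (y j).toNat ≤ 1 := Bool.toNat_le _
    calc c j * (y j).toNat ≤ c j * 1 := Nat.mul_le_mul_left _ this
      _ ≤ 2 ^ B - 1 := by omega
  rw [Finset.sum_const, Finset.card_univ, Fintype.card_fin, smul_eq_mul] at h1
  have h2 : M ≤ 2 ^ Nat.clog 2 M := Nat.le_pow_clog one_lt_two M
  have h3 : 1 ≤ 2 ^ B := Nat.one_le_two_pow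
  calc ∑ j, c j * (y j).toNat ≤ M * (2 ^ B - 1) := h1
    _ < M * 2 ^ B := (Nat.mul_lt_mul_left hM).2 (by omega)
    _ ≤ 2 ^ Nat.clog 2 M * 2 ^ B := Nat.mul_le_mul_right _ h2
    _ = 2 ^ wsumWidth M B := by rw [wsumWidth, pow_add, mul_comm]

/-- **Weighted thresholds in logarithmic depth** (Vollmer 1999, Thm. 1.20 with Thm. 1.24, in
weighted form): for weights `cⱼ < 2^B` and any threshold `θ`, the Boolean function
`y ↦ [θ ≤ ∑ⱼ cⱼ·[yⱼ]]` of `M` bits is computed by a `B₂`-circuit of depth `wsumDepth M B`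
(`= O(log M + log B)`) and size `wsumSize M B` (polynomial): the carry-save tree of the terms,
a look-ahead adder and a comparison with the hard-wired `θ`. [cite: Vollmer1999, Theorem 1.24] -/
theorem ncVec_wsumGe (M B : ℕ) (c : Fin M → ℕ) (hc : ∀ j, c j < 2 ^ B) (θ : ℕ) :
    NCVec (fun (y : Fin M → Bool) (_ : Unit) => decide (θ ≤ ∑ j, c j * (y j).toNat))
      (wsumDepth M B) (wsumSize M B) := by
  have hs1 : 1 ≤ wsumSize M B := Nat.le_add_left 1 _
  rcases Nat.eq_zero_or_pos M with rfl | hM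
  · exact ((ncVec_const (decide (θ ≤ 0))).congr fun y _ => by simp).mono
      (by simp [wsumDepth]) hs1
  set W := wsumWidth M B with hW
  have hcW : ∀ j, c j < 2 ^ W := fun j =>
    (hc j).trans_le (Nat.pow_le_pow_right two_pos (Nat.le_add_right _ _))
  have hT := ncVec_csTree W M hM c
  have hBits := hT.comp (ncVec_addBits W)
  have hCmp := hBits.comp (ncVec_geConst W θ)
  refine (hCmp.congr fun y _ => ?_).mono ?_ ?_
  · -- the compared number is `(s + e) mod 2^W = ∑ cⱼ[yⱼ]`
    rw [Nat.ofBits_testBit]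
    congr 2
    have hlt := wsum_lt_two_pow_wsumWidth M B c hc y
    have hval := csVal_csTree (W := W) M c hcW y
    unfold csVal at hval
    rw [ZMod.natCast_eq_natCast_iff', Nat.mod_eq_of_lt hlt] at hval
    exact hval
  · simp only [wsumDepth, ← hW]
    omega
  · simp only [wsumSize, ← hW]
    omega

end Literature.Computability.Complexity
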